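import Summits.HodgeConjecture.HodgeConjecture.Theses.AmpleAdicLefschetz
import Literature.AlgebraicGeometry.HodgeTheory.MiddleDimensionReductionProofs
import Literature.AlgebraicGeometry.HodgeTheory.HodgeTypePullback
import Literature.AlgebraicGeometry.HodgeTheory.HodgeFiltrationModelsReductionProofs
import Literature.AlgebraicGeometry.HodgeTheory.ComplexConjugationHolds

/-!
# Route AmpleAdicLefschetz — `MiddleStabilisation` (item stmt-HodgeConjecture-2616)

The support item `MiddleStabilisation` of route `AmpleAdicLefschetz`: if rational `(p,p)` classes
are algebraic on every smooth projective complex variety of dimension `2p + 1` (degree `2p`, the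
range `2p + 1 ≤ dim`), then rational `(p,p)` classes are algebraic on every smooth projective
complex variety of dimension `2p` (the middle degree).

Proof (the folklore product trick, exactly as the item's docstring prescribes; all ingredients are
theorems of the tree): for `X` smooth projective of dimension `2p`, `X × ℙ¹` is smooth projective of
dimension `2p + 1` (`Motives.IsSmoothProjective.tensor_holds`,
`Motives.isSmoothProjective_projectiveSpace_holds`); `pr₁^* : H^*(X(ℂ)) → H^*((X × ℙ¹)(ℂ))`
preserves Hodge types (`preservesHodgeType_of_nonempty_hodgeModel`, Voisin I §7.3.2, fed with the
discharged facts `hodgePQ_independent_of_hodgeModel_holds` and `nonempty_hodgeModel_holds`) and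
rational classes; so `pr₁^* c` is algebraic on `X × ℙ¹` by hypothesis, and
`c = s_t^* pr₁^* c` for a general slice `s_t = (𝟙, t) : X → X × ℙ¹` is algebraic
(`mem_algebraicClasses_of_projectiveLine_of_preservesHodgeType`, the Gysin-free `ℙ¹`-step of the
tree's proof of BFNP Lemma 48: the pull-back along a general slice of a class dying off a closed
`Z ⊆ X × ℙ¹` of codimension `≥ p` dies off `s_t⁻¹ Z`, of codimension `≥ p` in `X`).

References: P. Brosnan, H. Fang, Z. Nie, G. Pearlstein, Invent. Math. 177 (2009), §6 Lemma 48;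
C. Voisin, *Hodge Theory and Complex Algebraic Geometry I* (2002), §7.3.2; W. Fulton,
*Intersection Theory* (1998), §8.1 / Cor. 19.2.
-/

-- `Summit.HodgeConjecture.HodgeConjecture.Theorems` is the mandated namespace (single-problem summit:
-- Problem = Summit), which `linter.dupNamespace` flags on every declaration; the lakefile turns the
-- linter off tree-wide (weak option), restated here so stand-alone elaboration is warning-free too.
set_option linter.dupNamespace false

open CategoryTheory MonoidalCategory CartesianMonoidalCategory
open Literature.AlgebraicGeometry Literature.AlgebraicGeometry.HodgeTheory

namespace Summit.HodgeConjecture.HodgeConjecture.Theorems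

/-- **Item stmt-HodgeConjecture-2616 (`MiddleStabilisation`)**: if every rational `(p,p)` class on
every smooth projective complex variety of dimension `2p + 1` is algebraic, then every rational
`(p,p)` class on every smooth projective complex variety `X` of dimension `2p` is algebraic — apply
the hypothesis to `X × ℙ¹` and the class `pr₁^* c` (rational, of type `(p,p)` since `pr₁^*` is a
morphism of Hodge structures), and pull back along a general slice `X × {t}`
(`mem_algebraicClasses_of_projectiveLine_of_preservesHodgeType`). The type is literally the route
decl `Summit.HodgeConjecture.HodgeConjecture.Theses.AmpleAdicLefschetz.MiddleStabilisation`.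
[cite: BrosnanFangNiePearlstein2009, §6 Lemma 48 (proof)] [cite: VoisinHodgeI2002, §7.3.2] -/
theorem ampleAdicLefschetz_middleStabilisation_proof :
    Summit.HodgeConjecture.HodgeConjecture.Theses.AmpleAdicLefschetz.MiddleStabilisation := by
  unfold Summit.HodgeConjecture.HodgeConjecture.Theses.AmpleAdicLefschetz.MiddleStabilisation
  intro p hyp X hX c hc hpp
  -- `X × ℙ¹` is smooth projective of dimension `2p + 1`
  have hXP : Motives.IsSmoothProjective (2 * p + 1) (X ⊗ Motives.projectiveSpace 1 ℂ) :=
    Motives.IsSmoothProjective.tensor_holds hX (Motives.isSmoothProjective_projectiveSpace_holds ℂ 1)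
  -- `pr₁^*` is a morphism of Hodge structures (Voisin I §7.3.2), unconditionally in the tree
  have hfst : PreservesHodgeType (2 * p + 1) (2 * p) (fst X (Motives.projectiveSpace 1 ℂ)) :=
    preservesHodgeType_of_nonempty_hodgeModel hodgePQ_independent_of_hodgeModel_holds
      nonempty_hodgeModel_holds hXP hX (fst X (Motives.projectiveSpace 1 ℂ))
  -- the Gysin-free `ℙ¹`-step: `c = s_t^* pr₁^* c` for a general slice `s_t`
  exact mem_algebraicClasses_of_projectiveLine_of_preservesHodgeType hX hfst
    (fun κ hκ hκpp ↦ hyp hXP κ hκ hκpp) c hc hpp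

end Summit.HodgeConjecture.HodgeConjecture.Theorems
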